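import Summits.BirchSwinnertonDyer.BirchSwinnertonDyer.Theses.SignedLowerHalves
import Summits.BirchSwinnertonDyer.BirchSwinnertonDyer.Theorems.SignedLowerHalvesKobayashiMainConjectureSmallImageAcnsCrux
import Summits.BirchSwinnertonDyer.BirchSwinnertonDyer.Theorems.SignedLowerHalvesKobayashiMainConjectureSmallImageAcanchorGlueRatRatNotCM
import Summits.BirchSwinnertonDyer.BirchSwinnertonDyer.Theorems.SignedLowerHalvesKobayashiMainConjectureSmallImageAcanchorGlueRatRatNotCMCoprime
import Summits.BirchSwinnertonDyer.BirchSwinnertonDyer.Theorems.SignedLowerHalvesKobayashiMainConjectureSmallImageCycWindingMuThree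
import Summits.BirchSwinnertonDyer.BirchSwinnertonDyer.Theorems.SignedLowerHalvesKobayashiMainConjectureSmallImagePublishedInputsNsOfFiveOfMazur
import Summits.BirchSwinnertonDyer.BirchSwinnertonDyer.Theorems.SignedLowerHalvesKobayashiLowerHalfLargeImageHorocycleMuFloor
import HarnessLib

/-!
# Line `birth_acns` v13 — crux `KobayashiMainConjectureSmallImage` (route SignedLowerHalves, rank 4;
# item stmt-BirchSwinnertonDyer-19002): line `birth` cut along the designed line «acns», the one-sign rider,
# (v3/v4) BOTH engine stubs made RATIONAL, (v5) both engine stubs RESTRICTED TO NON-CM CURVES, and (v6) the one-sign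
# μ-rider SPLIT at p = 3 / p ≥ 5, and (v7/v8) its p = 3 half REDUCED TO GROUP THEORY OF Γ₀(N): «S₃ generates Γ′» (⇒ LEMMA′(N,3))
# and (v9) REDUCED TO PRINT: the single cited theorem (VL)₃ = Vaserstein–Liehl for SL₂(ℤ[1/3]) (bsd-idea-13 g9's kernel file)
# and (v10) PROVED, INPUT-FREE, from theorems of the tree (`Theorems/…SmallImageCycWindingMuThree.lean`): NO p = 3 μ-stub remains
# (v11) the HELD cite bundle re-cut to FIVE prints + Mazur 1978 Cor. 4.1 (INPUTS desk, p640631)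
# (v12) the p = 3 Eisenstein half CUT TO ITS p-INVERTED λ-PART (both signs) — the residual shared verbatim with crux 3's `stub_three`
# (v13) BOTH engine stubs RESTRICTED TO HEEGNER FIELDS WITH `p ∤ h_K` (vet rider (R); the sibling 20727's `bdpline_coprime` binder) — one more HELD print, BRR 2022 Thm. 1

Lead seat bsd-line-slh-p3 gen 6 (v3/v4) / gen 8 (v5), 2026-08-28 (v2: gen 5, `BirthAcnsCandidate.lean` 2b521a6074bd; pen word D34-9 (2):
the next 19002 LEAD may register `birth_acns` as a SECOND line, `Lines/birth.lean` b1bf5b11 untouched). Birth's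
composition idea is kept (Eisenstein half + saturation ⇒ the crux BY NAME); BOTH of birth's stubs are PROVED from the
six stubs below, by the landed files `Theorems/…SmallImageAcnsCrux.lean` (gen 5: descent without `Surj`),
`…SmallImageGaussInequality.lean` + `…SmallImageRationalRigidity.lean` + `…SmallImageRationalAnchor.lean` +
`…SmallImageAcanchorGlueRatRat.lean` (gen 6: T3 ⇐ T2_rat ∧ T1_rat by rational rigidity + saturation over
`𝒪_{ℂ_p}⟦T₂⟧⟦T₁⟧; the anchor half after the ideator bsd-idea-13 g5's workfile `RatAnchorSaturation.lean`) and k3-c4x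
lane B (p533653: saturation for every sign from the one-sign rider). v3 − v2 = `stub_ES2_ns` (INTEGRAL two-variable
Euler-system inclusion, blocked at normaliser-of-Cartan image by the missing `τ`) ↦ `stub_ES2rat_ns` (the same
inclusion UP TO `p^a` — what Euler systems give under `Hyp(K_∞, V)` alone, Rubin Thm. 2.3.3); v4 − v3 =
`stub_acDiv_ns` ↦ `stub_acDivRat_ns` (the anchor UP TO `p^b` — what a Λ-adic Kolyvagin-system argument at
prime-to-`p` image gives). BOTH `p`-powers are cancelled in the kernel against `μ(G⁻) = 0` (BCS 2025 Prop. 4.2.2,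
already an input) by the two-variable Gauss inequality / saturation — no algebraic `μ`, control or pseudo-nullity
input: at `p ≥ 5` NEITHER engine statement of the line has to be integral.

v5 − v4 (lead gen 8, 2026-08-28, `stub-misstated` ×2 repaired): the binder swap `Surj W p ↦ a_p = 0 → ¬ Surj W p`
that produced T2_rat / T1_rat from the bodies of cruxes 20728-rational / 20727 silently ENLARGED their domain by every
CM curve (tree theorem `WeierstrassCurve.not_hasSurjectiveModNGaloisRep_of_hasCM`: CM ⇒ never surjective at odd `p`;
`a_p = 0` at every good `p ≥ 5` inert in the CM field), whereas the big-image originals exclude CM curves and the crux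
itself carries `¬ W.HasCM`; on CM curves the line's engines do not run. Both engine stubs now carry `¬ W.HasCM →`
(right after `¬ Surj W p →`); the composition is unchanged BY NAME through the landed glue
`Theorems/…SmallImageAcanchorGlueRatRatNotCM.lean` (`¬CM` threaded to the twist factor by `j`-transport). v5 is a
WEAKENING of v4 (`eulerSystemRatNotCM_of_eulerSystemRat`, `acDivRatNotCM_of_acDivRat` there).

v6 − v5 (lead gen 8, after the ideator bsd-idea-13 g8's `EG-REDUCTION-g8.md` §7(a) and this gen's landed kernel reduction
`Theorems/…SmallImageOrbitSumMu.lean` p636207): `stub_muOneSign_ns` ↦ `stub_muOneSign_ns_three` ∧ `stub_muOneSign_ns_ge5`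
(`muOneSign_of_stubs` re-derives the v5 statement). At p = 3 the stub is now the MODULAR-SYMBOL statement «some plus symbol
`[u/3^{n+1}]⁺_f` (u a unit mod 3^{n+1}) is a 3-adic unit» — by `SmallImageOrbitSumMuThree.exists_sign_hasUnitContent_three_of_norm_ratPlusSymbol_eq_one`
(p636964, on `SmallImageOrbitSumMu` p636207) this gives `∃ ε₀ L₀, IsSignedPAdicLFunction f 3 ε₀ L₀ ∧ HasUnitContent L₀`; it is the negation of
«every [a/3^{n+1}]⁺_f ≡ 0 (mod 3)», which the ideator's LEMMA′ (Venkataramana 1994 /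
Vaserstein 1972 finite index + Serre 1970 CSP + the kernel-checked coset lemma `EGCosetLemma.lean`) and the Hecke identity at ℓ = 3
refute on paper (THEOREM A of `EG-REDUCTION-g8.md`, refereed by the lead at paper level: typing cost ≈ L, two new PUBLISHED facts).
At p ≥ 5 the rider keeps its v5 shape (residual OS₀(N,p) class-wide; per pair ONE unit orbit sum via the same file).

v7 − v6 (lead gen 8, after landing Module 2 = `Theorems/…SmallImageHeckePrimeMuPrelims.lean` p638955,
`…SmallImageHeckePrimeMu.lean`, `…SmallImageHeckePrimeMuThree.lean`): the p = 3 rider stub `stub_muOneSign_ns_three` (symbol form) is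
DERIVED (`muOneSignThree_of_stubs`) from the NEW registered stub `stub_lemmaPrime_three` = LEMMA′(N,3) for every N prime to 3 —
PURE GROUP THEORY of Γ₀(N): every homomorphism ψ : Γ₀(N) → ℤ/3 killing S₃ = {γ : d(γ) = ±3^k} is χ(d(γ) mod N) with χ
trivial on 3̄ (the ideator's LEMMA′; paper proof from Venkataramana 1994 / Vaserstein 1972 + Mennicke 1967 / Serre 1970 CSP +
the kernel-checked coset lemma; typing needs SL₂(ℤ[1/3]) vocabulary). Everything modular / analytic between LEMMA′ and the
signed rider is now kernel-checked (THEOREMS A/B of EG-REDUCTION-g8 modulo LEMMA′).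

v8 − v7 (lead gen 8, after landing `Theorems/…SmallImageLemmaPrimeReduction.lean` p640975 = EG-REDUCTION-g8 §1's factorisation step):
`stub_lemmaPrime_three` is DERIVED (`lemmaPrimeThree_of_stubs`) from the NEW registered stub `stub_SpGenerates_three` = (★★) at p = 3:
for every N prime to 3, every γ ∈ Γ₀(N) with d(γ) ≡ ±3^k (mod N) lies in the subgroup GENERATED by S₃ = {γ : d(γ) = ±3^k} — the exact output
of the ideator's EG + coset lemma (`EGCosetLemma.lean`) + transversality T±/S/V (typing plan `LemmaPrimeTypingPlan.md` §2–5).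

v9 − v8 (lead gen 8, 2026-08-28 ~15Z, after bsd-idea-13 g9's SORRY-FREE kernel files `Cruxes/…/EGLemmaPrime_g9.lean` (LEMMA′(N,p) in
homomorphism form ⇐ (VL) Vaserstein–Liehl relative elementary generation for SL₂(ℤ[1/p]): `ZInv p ⊂ ℚ`, `Δ′`, `B^±`, transversality T±,
coset lemma — 937 lines, farm-verified by the lead rc 0 / 0 sorries) and `EGTheoremA3_g9.lean` (whole chain, 1719 lines, rc 0 / 0 sorries),
and after landing the adapter `SmallImageLemmaPrimeReduction.lemmaPrime_of_homForm` (p642339)): `stub_SpGenerates_three` ((★★), v8) is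
REPLACED by the CITE-ONLY stub `stub_vasersteinLiehl_three` = (VL)₃ for every level N prime to 3, in the ideator's typing
(`EGLemmaPrimeG9.VasersteinLiehl 3 N`, imported from the crux module); LEMMA′(N,3) is DERIVED (`lemmaPrimeHomThree_of_stubs`,
`lemmaPrimeThree_of_stubs`). The p = 3 one-sign μ-rider of this crux is thereby reduced to ONE PUBLISHED THEOREM [Vaserstein 1972; Liehl 1981;
= Hutchinson arXiv:1412.0953 Thm 2.1 at K = ℚ, S = {∞,3}, (I₁,I₂) = (O_S, N·O_S)] plus kernel-checked mathematics. PORTING DEBT (honest): the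
crux module `EGLemmaPrime_g9` is not importable from `Theorems/`; before the crux can close, its 937 lines must be promoted (defs `ZInv`, `DeltaPrime`,
… review-queued; (VL) as a Literature fact) — successor task, see `Lines/birth-MEMO-slh-p3-8.md` rev 3.

v10 − v9 (lead gen 8, 2026-08-28 ~15:30Z): **the p = 3 one-sign μ-rider is PROVED, input-free** — `stub_vasersteinLiehl_three` and the
embedded copy of `EGLemmaPrime_g9` are GONE; `muOneSignThree_of_stubs` is now the tree theorem
`SmallImageCycWindingMuThree.exists_unit_norm_ratPlusSymbol_three_eq_one_of_isNewformOf` (this seat, p643729): the tree ALREADY PROVES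
Vaserstein's `G(ℤ[1/m], N·ℤ[1/m]) = E(ℤ[1/m], N·ℤ[1/m])` (`Literature/NumberTheory/Automorphic/CongruenceSubgroupPropertySL2AwayHolds.lean`,
`SL2Rel.Away.relG_top_span_natCast_le_relE`), THEOREM B «p-power cyclotomic winding classes span `pr Γ_H(N)`» by the orbit trick in
`SL₂(ℤ[1/p])` (`ConjSpanGenAllLevels`, cells bsd-f3-mu / bsd-print-x8) and its input-free corollary
`Rank1Residual.EvenBranch.cycWindingNonConstantAt_of_odd` (`Theorems/PrintX9EvenBranchMuZeroInputFree.lean`: odd good `p`, `E[p]` irreducible ⇒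
the plus symbol is non-constant `p`-adically on the `p`-power cusps), and Serre's Prop. 12 (`hasIrreducibleModPGaloisRep_of_dvd_frobeniusTrace`:
good supersingular ⇒ `E[p]` irreducible); composed with this seat's `3`-integrality / `K₀`-step / unit-residue descent and Module 1b
(`…OrbitSumMuThree`), this gives `∃ ε L, IsSignedPAdicLFunction f 3 ε L ∧ HasUnitContent L` for the newform of EVERY curve with good
reduction at 3 and `a₃ = 0`.  (The ideator bsd-idea-13 g8/g9's EG-REDUCTION road — LEMMA′ ⇐ (VL) — is thereby realised by the tree's own
THEOREM B road; v7–v9's group-theoretic stubs were the right diagnosis.)  Stubs: 6.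

v11 − v10 (lead gen 8, 2026-08-28 ~16Z): `stub_publishedInputs_ns` RE-CUT as the INPUTS desk proposed (p640631
`Theorems/…PublishedInputsNsOfFiveOfMazur.lean`, prover-bsd-inputs-honda-p1 g12): FIVE printed inputs (Kobayashi Thm 4.1 · Thm 1.2 · Thms 6.2/6.3/7.3 i)
Coleman–Kato ζ · BCDT modular parametrisation · BCS 2025 Prop 4.2.2) ∧ Mazur 1978 Cor. 4.1 (`mazur_not_dvd_maninConstant_of_odd`); the period-unit
pair F5/F6 is DERIVED (`publishedInputs_of_stubs` via `InputsPublishedNs.publishedInputs_ns_of_five_of_mazur`).  Also landed this cycle (tree knowledge,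
not a stub change): p645198 `Theorems/…SmallImageTeichOrbitMu.lean` — `stub_muOneSign_ns_ge5` VERBATIM ⟸ the tree's Conjecture B⁰ `TeichSpanGenAll`
(cell bsd-f3-mu; OPEN), and unconditionally ⟸ `TeichOrbitNonConstantAt W p` at any odd supersingular prime.  Stubs: 6.

v12 − v11 (lead gen 10, 2026-08-28 ~17:3xZ, after width seat slh-p1-w2 g5's p648511
`Theorems/…KobayashiLowerHalfLargeImageHorocycleMuFloor.lean`): `stub_threeLower_ns` (∃ ε, the INTEGRAL Eisenstein half
`KobayashiLowerDivisibility W 3 ε` on the crux's p = 3 rows; «no source») is DERIVED (`threeLower_of_stubs`) from the NEW registered stub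
`stub_lambdaLowerThree_ns` = the p-INVERTED signed lower divisibility at 3 for BOTH signs («`ϖ·L³_ε ∣ 3^m·g`, `g` a generator of
`char X^ε`» — VERBATIM crux 3's `LambdaLowerDivisibility W 3 ε` of line `horocycle_mu_floor`, unfolded) on the same rows, by the IMAGE-FREE
tree theorem `HorocycleMuFloor.X7.exists_kobayashiLowerDivisibility_three_of_pInverted` (μ-side = this crux's input-free p = 3 rider p643729,
upgrade = w2's door p647721, period unit `h3` = `realPeriodRat_eq_unit_mul_plusPeriod_three`, already the 4th conjunct of
`publishedInputs_of_stubs`).  The p = 3 residual of THIS crux and of crux 3 (`stub_three`, `Surj` instead of `¬Surj`) are now the SAME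
statement up to the idle image binder: prove once, close twice.  PRE-adjacent (rational signed IMC at p = 3: Kato's `Λ⊗ℚ` divisibility is the
other direction; this direction is the Eisenstein/finite-slope engine — Fouquet–Wan universal IMC, CÇSS 2018 for square-free level).  Stubs: 6.

v13 − v12 (lead gen 11, 2026-08-28 ~18:3xZ, after the one-shot vet `bsd-vet-k3c4-eng` g0 of the split turnkey #2 v2 — C1/C2 PASS as typed,
rider (R) «`¬ p ∣ h_K` RECOMMENDED for provability parity with 20727-coprime» — and this seat's landed glue
`Theorems/…SmallImageAcanchorGlueRatRatNotCMCoprime.lean`): BOTH engine stubs carry the binder `¬ p ∣ NumberField.classNumber K →`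
inserted right after `κ₂.IsAnticyclotomic →` — EXACTLY the token of the sibling crux stmt-20727's workfile `Lines/bdpline_coprime.lean`
(route SignedBaseChange).  WHY: on the sub-cell `p ∣ h_K` the printed anticyclotomic signed theory at a supersingular prime
(Iovita–Pollack / B.-D. Kim / Longo–Vigni / Castella–Wan; tree `AcSigned.Setting.not_dvd_classNumber`) does not run even rationally, so
the un-bindered T1_rat quantifies over Heegner fields that no engine in print reaches; the composition eats ONE `K` (the frame is existential),
so the binder costs only a SUPPLY of Heegner fields with `2`, `p`, `ℓ`, the primes of `N` split AND `p ∤ h_K` — the tree's even rung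
`BiquadraticEisensteinDescentHeegnerFieldSupplyEvenRung.exists_twoSplit_split_not_dvd_classNumber`, CONDITIONAL on the refereed named fact
`Literature.NumberTheory.QuadraticFields.BRR2022_thm_1` (Beckwith–Raum–Richter, Adv. Math. 409 (2022), Thm. 1), which joins the HELD cite
bundle as its SEVENTH print (`stub_publishedInputs_ns` = five prints ∧ Mazur 1978 Cor. 4.1 ∧ BRR 2022 Thm. 1).  v13 is a WEAKENING of v12 on
the engines (`SmallImageAcanchorGlueRatRatNotCMCoprime.eulerSystemRatNotCMCoprime_of_eulerSystemRatNotCM`, `…acDivRatNotCMCoprime_of_acDivRatNotCM`)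
and one refereed print heavier on the inputs; the composition is unchanged BY NAME (`canonical_ns_of_stubs` now through
`…canonicalNs_of_eulerSystemRatNotCMCoprime_of_acDivRatNotCMCoprime_noSurj`, frame = FD″-noSurj ∧ `p ∤ h_K`).  Stubs: 6.

* `stub_ES2rat_ns` (T2_rat) and `stub_acDivRat_ns` (T1_rat) — the two ENGINE statements, both RATIONAL: T2_rat =
  line `ratlift`'s `stub_ratEulerSystemSS` (crux stmt-20728) with `Surj` ↦ `¬Surj`; T1_rat = SignedBaseChange's
  acanchor stub ACdiv (body of stmt-20727, line `bdpline`) with the same swap and the conclusion multiplied by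
  `(p^b)`. OPEN / PRE-adjacent (L2 rational signed Beilinson–Flach divisibility at `a_p = 0`; L1 the rational
  anticyclotomic Eisenstein inclusion at supersingular prime-to-`p` image; v13: both on Heegner fields with `p ∤ h_K` only).
  T3 (`CanonicalNs`) is DERIVED (`canonical_ns_of_stubs`; v13: granted BRR 2022 Thm. 1 = 3rd conjunct of `stub_publishedInputs_ns`).
* `stub_muOneSign_ns_ge5` (v6) — the ONE-SIGN analytic μ-rider of the crux's own curve at p ≥ 5, VERBATIM k3-c4x's `hμan₀`
  (its p = 3 half is PROVED input-free since v10: `muOneSignThree_of_stubs` has no stub behind it)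
  (`min(μ⁺, μ⁻) = 0`; OPEN class-wide = OS₀(N,p), per pair ONE unit orbit sum).
* `stub_publishedInputs_ns` — HELD, cite-only (v11: FIVE prints — Kobayashi Thm 4.1 / 1.2, Coleman–Kato ζ construction fact,
  modularity with parametrisation, BCS 2025 Prop 4.2.2 — ∧ Mazur 1978 Cor. 4.1 ∧ (v13) Beckwith–Raum–Richter 2022 Thm. 1; the period-unit pair is derived).
* `stub_preprintInputs_ns` — PRE, cite-only (BSTW Thm 6.17 common frame, signed two-variable package).
* `stub_lambdaLowerThree_ns` (v12) — the p-INVERTED Eisenstein half (both signs) on the `p = 3` rows (the PRE binders carry `5 ≤ p`);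
  the integral `∃ ε` half `threeLower_of_stubs` is DERIVED (μ-rider at 3 + door + `h3`).

Composition `KobayashiMainConjectureSmallImage_of` = `SmallImageAcnsCrux.kobayashiMainConjectureSmallImage_of_acns`.
Kernel-checked (farm rc 0); sorries only in the six stubs (two engines, v13: on `p ∤ h_K`; the p ≥ 5 μ-rider; two cite bundles HELD / PRE; the p = 3 λ-part).
HONEST: crux 4 OPEN; BSD not proved by this seat; nothing here asserts the PRE binders or the held facts (incl. BRR 2022 Thm. 1).
-/

set_option autoImplicit false
set_option linter.dupNamespace false

noncomputable section

open scoped Classical MatrixGroups ModularForm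

namespace Summit.BirchSwinnertonDyer.BirchSwinnertonDyer.Cruxes.KobayashiMainConjectureSmallImage.BirthAcns

open CongruenceSubgroup Literature.NumberTheory.EllipticCurves Literature.NumberTheory.EllipticCurves.Rank1Residual
  Literature.NumberTheory.EllipticCurves.ModularForms Literature.NumberTheory.EllipticCurves.Kobayashi2003
  Literature.NumberTheory.EllipticCurves.GreenbergVatsal2000
  Literature.NumberTheory.EllipticCurves.BurungaleSkinnerTianWan2024
  Literature.NumberTheory.EllipticCurves.BurungaleCastellaSkinner2025
  Summit.BirchSwinnertonDyer.Rank1Residual.Supersingular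

/-- stub T2_rat¬CM,h of «acns» (v13 = v5's T2_rat¬CM with the binder `¬ p ∣ NumberField.classNumber K →` after `κ₂.IsAnticyclotomic →` — the 20727-coprime shape; v5 = v3's T2_rat with the binder `¬ W.HasCM →` added — the CM leak of the `Surj ↦ ¬Surj` swap closed; the RATIONAL two-variable Euler-system inclusion `∃ a, (p^a·G) ⊆ ch(X_Gr₂(E/K̃_∞))^{ur}`
on the small-image supersingular domain — VERBATIM line `ratlift`'s `stub_ratEulerSystemSS` of crux stmt-20728 (route
SignedBaseChange) with the binder `Surj W p →` replaced by `¬ Surj W p →` and the `SignedTwoVariableInputs →` prefix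
replaced by the parametrisation fact (as v2's T2); = v2's `stub_ES2_ns` with exactly the `μ`-part forgotten. What
two-variable Euler-system machinery yields WITHOUT the big-image/`τ` hypothesis (Rubin Thm. 2.3.3); integrality is
recovered in the composition by RATIONAL RIGIDITY (`…SmallImageRationalRigidity`, gen 6) from T1 + BCS25 Prop. 4.2.2.
PRE-adjacent (signed Beilinson–Flach classes at `a_p = 0`: BSTW 2024 / Büyükboduk–Lei), not in print as stated. -/
theorem stub_ES2rat_ns : Literature.NumberTheory.EllipticCurves.ModularForms.nonempty_modularParametrizationData → ∀ (W : WeierstrassCurve ℚ) [W.IsElliptic] [W.IsGloballyMinimal] (p : ℕ) [Fact p.Prime], 5 ≤ p → W.HasGoodReductionAtPrime p → W.frobeniusTrace p = 0 → ¬ Literature.NumberTheory.EllipticCurves.Rank1Residual.Surj W p → ¬ W.HasCM → ∀ (K : Type) [Field K] [NumberField K] (ι : PadicAlgCl p ≃+* ℂ) (v vbar : IsDedekindDomain.HeightOneSpectrum (NumberField.RingOfIntegers K)) (κ₁ κ₂ : ZpExtension K p) (γ₁ γ₂ : Field.absoluteGaloisGroup K) [Fact (ZpExtension.IsTopGeneratorPair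 κ₁ κ₂ γ₁ γ₂)] [NeZero (NumberField.discr K).natAbs] (N : ℕ) [NeZero N] (f : CuspForm (CongruenceSubgroup.Gamma0 N) 2), IsNewformOf W f → (N : ℤ) = W.conductorNorm ℤ → IsImaginaryQuadratic K → ((Ideal.span {(p : ℤ)}).primesOver (NumberField.RingOfIntegers K)).ncard = 2 → ((p : ℕ) : NumberField.RingOfIntegers K) ∈ v.asIdeal → ((p : ℕ) : NumberField.RingOfIntegers K) ∈ vbar.asIdeal → vbar ≠ v → (∀ (w : NumberField.InfinitePlace K) (k : NumberField.RingOfIntegers K), k ∈ v.asIdeal ↔ ‖ι.symm (w.embedding (k : K))‖ < 1) → IsCoprime (N : ℤ) (NumberField.discr K) → (∀ ℓ : ℕ, ℓ.Prime → ℓ ∣ N → ((Ideal.span {(ℓ : ℤ)}).primesOver (NumberField.RingOfIntegers K)).ncard = 2) → Odd (NumberField.discr K) → NumberField.discr K ≠ -3 → κ₁.IsCyclotomic → κ₂.IsAnticyclotomic → ¬ p ∣ NumberField.classNumber K → ∀ (Ω δ : ℂ) (Ωp : (unrIntegers p)ˣ) (LK G : PowerSeries (PowerSeries (PadicComplexInt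 p))), Ω ≠ 0 → (δ ^ 2 = (NumberField.discr K : ℂ) ∨ δ ^ 2 = -(NumberField.discr K : ℂ)) → IsKatzMeasure₂ ι v vbar ∅ κ₁ κ₂ γ₁⁻¹ γ₂⁻¹ 1 Ω δ ((Ωp : unrIntegers p) : PadicComplex p) LK → IsGreenbergLFunctionAnyRoot₂ ι v vbar κ₁ κ₂ γ₁⁻¹ γ₂⁻¹ f (NumberField.discr K).natAbs (NumberField.classNumber K) LK G → ∀ J : ℤ_[p] →+* PadicComplexInt p, (∀ x : ℤ_[p], ((J x : PadicComplexInt p) : PadicComplex p) = ((x : ℚ_[p]) : PadicComplex p)) → ∃ a : ℕ, Ideal.span {((p : ℕ) : PowerSeries (PowerSeries (PadicComplexInt p))) ^ a * G} ≤ (WeierstrassCurve.XGr₂.charIdeal (W.baseChange K) p κ₁ κ₂ vbar γ₁ γ₂).map (IwasawaAlgebra₂.toUnr₂ p J) := by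
  sorry

/-- stub T1_rat¬CM,h of «acns» (v13 = v5's T1_rat¬CM with the binder `¬ p ∣ NumberField.classNumber K →` after `κ₂.IsAnticyclotomic →` — the 20727-coprime shape, the cell on which the printed anticyclotomic ± theory runs; v5 = v4's T1_rat with the binder `¬ W.HasCM →` added — the CM leak of the `Surj ↦ ¬Surj` swap closed; the RATIONAL anticyclotomic Eisenstein inclusion on `T₁ = 0`:
`∃ b, (p^b)·ch^{ur}|_{T₁=0} ⊆ (G⁻)` — VERBATIM the acanchor stub ACdiv / item stmt-20727's body with the binder swap
`Surj W p →` ↦ `W.frobeniusTrace p = 0 → ¬ Surj W p →` and the conclusion multiplied by `(p^b)`; = v2/v3's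
`stub_acDiv_ns` with exactly the `μ`-part forgotten. Engine L1 = Howard's Λ-adic Heegner-point Kolyvagin bound run
at supersingular prime-to-`p` image (its error terms bounded, not zero ⇒ a `p^b`) + the BDP-side Eisenstein inclusion
(line `bdpline` of crux 20727, S1-rat); the `p^b` is cancelled in the composition by SATURATION of `(G⁻)` under
constants (`…SmallImageRationalAnchor`, gen 6, after the ideator's `RatAnchorSaturation.lean`) from BCS25 Prop.
4.2.2. OPEN / PRE-adjacent. -/
theorem stub_acDivRat_ns : Literature.NumberTheory.EllipticCurves.ModularForms.nonempty_modularParametrizationData → ∀ (W : WeierstrassCurve ℚ) [W.IsElliptic] [W.IsGloballyMinimal] (p : ℕ) [Fact p.Prime], 5 ≤ p → W.HasGoodReductionAtPrime p → W.frobeniusTrace p = 0 → ¬ Literature.NumberTheory.EllipticCurves.Rank1Residual.Surj W p → ¬ W.HasCM → ∀ (K : Type) [Field K] [NumberField K] (ι : PadicAlgCl p ≃+* ℂ) (v vbar : IsDedekindDomain.HeightOneSpectrum (NumberField.RingOfIntegers K)) (κ₁ κ₂ : ZpExtension K p) (γ₁ γ₂ : Field.absoluteGaloisGroup K) [Fact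 (ZpExtension.IsTopGeneratorPair κ₁ κ₂ γ₁ γ₂)] [NeZero (NumberField.discr K).natAbs] (N : ℕ) [NeZero N] (f : CuspForm (CongruenceSubgroup.Gamma0 N) 2), IsNewformOf W f → (N : ℤ) = W.conductorNorm ℤ → IsImaginaryQuadratic K → ((Ideal.span {(p : ℤ)}).primesOver (NumberField.RingOfIntegers K)).ncard = 2 → ((p : ℕ) : NumberField.RingOfIntegers K) ∈ v.asIdeal → ((p : ℕ) : NumberField.RingOfIntegers K) ∈ vbar.asIdeal → vbar ≠ v → (∀ (w : NumberField.InfinitePlace K) (k : NumberField.RingOfIntegers K), k ∈ v.asIdeal ↔ ‖ι.symm (w.embedding (k : K))‖ < 1) → IsCoprime (N : ℤ) (NumberField.discr K) → (∀ ℓ : ℕ, ℓ.Prime → ℓ ∣ N → ((Ideal.span {(ℓ : ℤ)}).primesOver (NumberField.RingOfIntegers K)).ncard = 2) → Odd (NumberField.discr K) → NumberField.discr K ≠ -3 → κ₁.IsCyclotomic → κ₂.IsAnticyclotomic → ¬ p ∣ NumberField.classNumber K → ∀ (Ω δ : ℂ) (Ωp : (unrIntegers p)ˣ) (LK G : PowerSeries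 (PowerSeries (PadicComplexInt p))), Ω ≠ 0 → (δ ^ 2 = (NumberField.discr K : ℂ) ∨ δ ^ 2 = -(NumberField.discr K : ℂ)) → IsKatzMeasure₂ ι v vbar ∅ κ₁ κ₂ γ₁⁻¹ γ₂⁻¹ 1 Ω δ ((Ωp : unrIntegers p) : PadicComplex p) LK → IsGreenbergLFunctionAnyRoot₂ ι v vbar κ₁ κ₂ γ₁⁻¹ γ₂⁻¹ f (NumberField.discr K).natAbs (NumberField.classNumber K) LK G → ∀ J : ℤ_[p] →+* PadicComplexInt p, (∀ x : ℤ_[p], ((J x : PadicComplexInt p) : PadicComplex p) = ((x : ℚ_[p]) : PadicComplex p)) → ∃ b : ℕ, Ideal.span {((p : ℕ) : PowerSeries (PadicComplexInt p)) ^ b} * ((WeierstrassCurve.XGr₂.charIdeal (W.baseChange K) p κ₁ κ₂ vbar γ₁ γ₂).map (IwasawaAlgebra₂.toUnr₂ p J)).map (PowerSeries.constantCoeff (R := PowerSeries (PadicComplexInt p))) ≤ Ideal.span {UnrSeries₂.minus G} := by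
  sorry

/-- stub (HELD, cite-only — PUBLISHED named facts / one reviewed construction fact, none with `_holds`; v11 re-cut = the INPUTS desk's
five prints ∧ Mazur 1978 Cor. 4.1; v13: ∧ Beckwith–Raum–Richter 2022 Thm. 1): Kobayashi Thm 4.1, Thm 1.2, the Coleman–Kato ζ construction fact
(Thm 6.2/6.3/7.3), modularity with parametrisation, BCS 2025 Prop 4.2.2; Mazur's `p ∤ c_Manin` for odd `p` (from which the period units at
`p ≥ 5` and `p = 3` follow, p640631); and the Hurwitz-class-number indivisibility `BRR2022_thm_1` (Adv. Math. 409 (2022), Thm. 1), which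
supplies the v13 frame's Heegner field with `p ∤ h_K` (`SmallImageAcanchorGlueRatRatNotCMCoprime.frameData_canonical_noSurj_coprimeClassNumber`). -/
theorem stub_publishedInputs_ns :
    (Literature.NumberTheory.EllipticCurves.Kobayashi2003.thm41_signedCharIdeal_divisibility ∧
      Literature.NumberTheory.EllipticCurves.Kobayashi2003.thm12_signedSelmerDual_finite_torsion ∧
      Literature.NumberTheory.EllipticCurves.Kobayashi2003.thm62_63_73_signedColemanKato_zeta ∧
      Literature.NumberTheory.EllipticCurves.ModularForms.nonempty_modularParametrizationData ∧
      Literature.NumberTheory.EllipticCurves.BurungaleCastellaSkinner2025.prop422_greenbergAnyRoot_hasUnitContent_minus) ∧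
    Literature.NumberTheory.EllipticCurves.ModularForms.mazur_not_dvd_maninConstant_of_odd ∧
    Literature.NumberTheory.QuadraticFields.BRR2022_thm_1 := by
  sorry

/-- **T3 (`CanonicalNs`, the K1″-shaped package on the crux's domain) DERIVED from T1_rat¬CM,h ∧ T2_rat¬CM,h** by the landed glue
`SmallImageAcanchorGlueRatRatNotCMCoprime.canonicalNs_of_eulerSystemRatNotCMCoprime_of_acDivRatNotCMCoprime_noSurj` (v13; v5–v12 used
`SmallImageAcanchorGlueRatRatNotCM.canonicalNs_of_eulerSystemRatNotCM_of_acDivRatNotCM_noSurj`) (frame supply WITH `p ∤ h_K` granted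
Beckwith–Raum–Richter 2022 Thm. 1 = the 3rd conjunct of `stub_publishedInputs_ns` + rational anchor + saturation + RATIONAL rigidity,
image clauses from Matar–Nekovář; ACμ⁺ `μ(G⁻) = 0` from BCS Prop 4.2.2 = first conjunct of the inputs). No sorry of its own. -/
theorem canonical_ns_of_stubs :
    (Literature.NumberTheory.EllipticCurves.BurungaleCastellaSkinner2025.prop422_greenbergAnyRoot_hasUnitContent_minus ∧ Literature.NumberTheory.EllipticCurves.BurungaleSkinnerTianWan2024.props118_27_519_exists_signedTwoVariablePackage_supersingular_PRE) → Literature.NumberTheory.EllipticCurves.ModularForms.nonempty_modularParametrizationData → ∀ (W : WeierstrassCurve ℚ) [W.IsElliptic] [W.IsGloballyMinimal] (p : ℕ) [Fact p.Prime], 5 ≤ p → Literature.NumberTheory.EllipticCurves.Rank1Residual.ClassX7 W p → ¬ W.HasCM → W.frobeniusTrace p = 0 → ¬ Literature.NumberTheory.EllipticCurves.Rank1Residual.Surj W p → ∃ (K : Type) (_ : Field K) (_ : NumberField K) (ι : PadicAlgCl p ≃+* ℂ) (v vbar : IsDedekindDomain.HeightOneSpectrum (NumberField.RingOfIntegers K))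 (κ₁ κ₂ : Literature.NumberTheory.EllipticCurves.ZpExtension K p) (γ₁ γ₂ : Field.absoluteGaloisGroup K) (_ : Fact (Literature.NumberTheory.EllipticCurves.ZpExtension.IsTopGeneratorPair κ₁ κ₂ γ₁ γ₂)) (_ : NeZero (NumberField.discr K).natAbs) (N : ℕ) (_ : NeZero N) (f : CuspForm (CongruenceSubgroup.Gamma0 N) 2) (d : ℤ) (W' : WeierstrassCurve ℚ) (_ : W'.IsElliptic) (_ : W'.IsGloballyMinimal) (C : WeierstrassCurve.VariableChange ℚ) (N' : ℕ) (_ : NeZero N') (f' : CuspForm (CongruenceSubgroup.Gamma0 N') 2), Literature.NumberTheory.EllipticCurves.ModularForms.IsNewformOf W f ∧ (N : ℤ) = W.conductorNorm ℤ ∧ Literature.NumberTheory.EllipticCurves.ModularForms.IsNewformOf W' f' ∧ (N' : ℤ) = W'.conductorNorm ℤ ∧ Squarefree d ∧ 1 < d ∧ (∀ q : ℕ, q.Prime → Literature.NumberTheory.EllipticCurves.BurungaleSkinnerTianWan2024.RamifiedInQuadratic d q → q ≠ p ∧ ¬ q ∣ N ∧ ¬ (q : ℤ) ∣ NumberField.discr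 K) ∧ C • W' = W.quadraticTwist (d : ℚ) ∧ Literature.NumberTheory.EllipticCurves.IsImaginaryQuadratic K ∧ ((Ideal.span {(p : ℤ)}).primesOver (NumberField.RingOfIntegers K)).ncard = 2 ∧ ((p : ℕ) : NumberField.RingOfIntegers K) ∈ v.asIdeal ∧ ((p : ℕ) : NumberField.RingOfIntegers K) ∈ vbar.asIdeal ∧ vbar ≠ v ∧ (∀ (w : NumberField.InfinitePlace K) (k : NumberField.RingOfIntegers K), k ∈ v.asIdeal ↔ ‖ι.symm (w.embedding (k : K))‖ < 1) ∧ IsCoprime (N : ℤ) (NumberField.discr K) ∧ (∀ ℓ : ℕ, ℓ.Prime → ℓ ∣ N → ((Ideal.span {(ℓ : ℤ)}).primesOver (NumberField.RingOfIntegers K)).ncard = 2) ∧ (∀ ℓ : ℕ, ℓ.Prime → (ℓ : ℤ) ∣ d → ((Ideal.span {(ℓ : ℤ)}).primesOver (NumberField.RingOfIntegers K)).ncard = 2) ∧ ((Ideal.span {(2 : ℤ)}).primesOver (NumberField.RingOfIntegers K)).ncard = 2 ∧ (∀ ρ : Literature.NumberTheory.GaloisRepresentations.ModPGaloisRep K (ZMod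 p) 2, (W.baseChange K).IsTorsionGaloisRep p ρ → Literature.NumberTheory.GaloisRepresentations.FramedRep.IsAbsolutelyIrreducible ρ) ∧ κ₁.IsCyclotomic ∧ κ₂.IsAnticyclotomic ∧ (∃ ζ : ℤ_[p]ˣ, IsOfFinOrder ζ ∧ ((Literature.NumberTheory.GaloisRepresentations.GaloisRep.cyclotomicCharacter K p γ₁ * ζ : ℤ_[p]ˣ) : ℤ_[p]) = (Literature.NumberTheory.EllipticCurves.cyclotomicGenerator p : ℤ_[p])) ∧ ∀ (Ω δ : ℂ) (Ωp : (Literature.NumberTheory.EllipticCurves.unrIntegers p)ˣ) (LK G G' : PowerSeries (PowerSeries (PadicComplexInt p))), Ω ≠ 0 → (δ ^ 2 = (NumberField.discr K : ℂ) ∨ δ ^ 2 = -(NumberField.discr K : ℂ)) → Literature.NumberTheory.EllipticCurves.IsKatzMeasure₂ ι v vbar ∅ κ₁ κ₂ γ₁⁻¹ γ₂⁻¹ 1 Ω δ ((Ωp : Literature.NumberTheory.EllipticCurves.unrIntegers p) : PadicComplex p) LK → Literature.NumberTheory.EllipticCurves.IsGreenbergLFunctionAnyRoot₂ ι v vbar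 κ₁ κ₂ γ₁⁻¹ γ₂⁻¹ f (NumberField.discr K).natAbs (NumberField.classNumber K) LK G → Literature.NumberTheory.EllipticCurves.IsGreenbergLFunctionAnyRoot₂ ι v vbar κ₁ κ₂ γ₁⁻¹ γ₂⁻¹ f' (NumberField.discr K).natAbs (NumberField.classNumber K) LK G' → ∀ J : ℤ_[p] →+* PadicComplexInt p, (∀ x : ℤ_[p], ((J x : PadicComplexInt p) : PadicComplex p) = ((x : ℚ_[p]) : PadicComplex p)) → ∃ s : PowerSeries (PadicComplexInt p), s ≠ 0 ∧ Ideal.span {PowerSeries.map (PowerSeries.C (R := PadicComplexInt p)) s} * ((WeierstrassCurve.XGr₂.charIdeal (W.baseChange K) p κ₁ κ₂ vbar γ₁ γ₂).map (Literature.NumberTheory.EllipticCurves.IwasawaAlgebra₂.toUnr₂ p J) * (WeierstrassCurve.XGr₂.charIdeal (W'.baseChange K) p κ₁ κ₂ vbar γ₁ γ₂).map (Literature.NumberTheory.EllipticCurves.IwasawaAlgebra₂.toUnr₂ p J)) ≤ Ideal.span {G * G'} :=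
  Summit.BirchSwinnertonDyer.BirchSwinnertonDyer.Theorems.SmallImageAcanchorGlueRatRatNotCMCoprime.canonicalNs_of_eulerSystemRatNotCMCoprime_of_acDivRatNotCMCoprime_noSurj
    stub_publishedInputs_ns.2.2 stub_ES2rat_ns stub_acDivRat_ns

/-- **v6's `stub_muOneSign_ns_three` (one unit plus symbol `[u/3^{n+1}]⁺_f`) — PROVED, input-free (v10)**: the tree theorem
`SmallImageCycWindingMuThree.exists_unit_norm_ratPlusSymbol_three_eq_one_of_isNewformOf` (p643729: THEOREM B road of the tree on Vaserstein's
theorem proved in `CongruenceSubgroupPropertySL2AwayHolds`, `EvenBranch.cycWindingNonConstantAt_of_odd`, Serre Prop. 12, this seat's descent).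
The class hypotheses `ClassX7`, `¬CM`, `¬Surj` are not even used: good reduction at 3 and `a₃ = 0` suffice. No sorry behind it. -/
theorem muOneSignThree_of_stubs : ∀ (W : WeierstrassCurve ℚ) [W.IsElliptic] [W.IsGloballyMinimal],
    ClassX7 W 3 → ¬ W.HasCM → W.frobeniusTrace 3 = 0 → ¬ Surj W 3 →
    ∀ [NeZero (W.conductorNorm ℤ)] (f : CuspForm (Gamma0 (W.conductorNorm ℤ)) 2),
    IsNewformOf W f → ∃ (n : ℕ) (u : (ZMod (3 ^ (n + 1)))ˣ),
      ‖((ratPlusSymbol f (((u : ZMod (3 ^ (n + 1))).val : ℚ) / (3 : ℚ) ^ (n + 1)) : ℚ) : ℚ_[3])‖ = 1 := by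
  intro W _ _ hX _ hap _ _ f hf
  have hgood : W.HasGoodReductionAtPrime 3 := hX.1.1
  exact Summit.BirchSwinnertonDyer.BirchSwinnertonDyer.Theorems.SmallImageCycWindingMuThree.exists_unit_norm_ratPlusSymbol_three_eq_one_of_isNewformOf
    f hf hgood hap

/-- stub (v6; the one-sign analytic μ-rider AT p ≥ 5, VERBATIM k3-c4x's `hμan₀` restricted to `5 ≤ p`): for the conductor-level
newform of `E`, SOME signed Pollack function has unit content (OPEN class-wide = OS₀(N,p) of EG-REDUCTION-g8 §5; per pair ONE unit
ω⁰ orbit sum Σ_η [ηγ^s/p^{n+1}]⁺ via `SmallImageOrbitSumMu.exists_sign_hasUnitContent_of_norm_coeff_eq_one`). -/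
theorem stub_muOneSign_ns_ge5 : ∀ (W : WeierstrassCurve ℚ) [W.IsElliptic] [W.IsGloballyMinimal] (p : ℕ) [Fact p.Prime],
    5 ≤ p → ClassX7 W p → ¬ W.HasCM → W.frobeniusTrace p = 0 → ¬ Surj W p →
    ∀ [NeZero (W.conductorNorm ℤ)] (f : CuspForm (Gamma0 (W.conductorNorm ℤ)) 2),
    IsNewformOf W f → ∃ (ε₀ : ℤˣ) (L₀ : IwasawaAlgebra p),
      IsSignedPAdicLFunction f p ε₀ L₀ ∧ HasUnitContent L₀ := by
  sorry

/-- **The v5 rider `stub_muOneSign_ns` DERIVED from the two v6 stubs** (case split `p = 3` / `5 ≤ p` for an odd prime; at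
`p = 3` the unit plus symbol gives a signed function with unit content by the landed
`SmallImageOrbitSumMuThree.exists_sign_hasUnitContent_three_of_norm_ratPlusSymbol_eq_one`, existence of `L_p^ε` being the tree THEOREM
`pollack_exists_plusMinusPAdicLFunction_holds`). No sorry of its own. -/
theorem muOneSign_of_stubs : ∀ (W : WeierstrassCurve ℚ) [W.IsElliptic] [W.IsGloballyMinimal] (p : ℕ) [Fact p.Prime],
    p ≠ 2 → ClassX7 W p → ¬ W.HasCM → W.frobeniusTrace p = 0 → ¬ Surj W p →
    ∀ [NeZero (W.conductorNorm ℤ)] (f : CuspForm (Gamma0 (W.conductorNorm ℤ)) 2),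
    IsNewformOf W f → ∃ (ε₀ : ℤˣ) (L₀ : IwasawaAlgebra p),
      IsSignedPAdicLFunction f p ε₀ L₀ ∧ HasUnitContent L₀ := by
  intro W _ _ p _ hp2 hX hCM hap hs _ f hf
  have hpP : p.Prime := Fact.out
  by_cases h3 : p = 3
  · subst h3
    obtain ⟨n, u, hunit⟩ := muOneSignThree_of_stubs W hX hCM hap hs f hf
    exact Summit.BirchSwinnertonDyer.BirchSwinnertonDyer.Theorems.SmallImageOrbitSumMuThree.exists_sign_hasUnitContent_three_of_norm_ratPlusSymbol_eq_one
      f hf hX.1.1 hap u hunit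
  · have h5 : 5 ≤ p := by
      rcases hpP.eq_two_or_odd' with h | h
      · exact absurd h hp2
      · have h2 := hpP.two_le
        by_contra hlt
        interval_cases p <;> simp_all (config := {decide := true})
    exact stub_muOneSign_ns_ge5 W p h5 hX hCM hap hs f hf

/-- **v6–v10's seven-conjunct HELD bundle DERIVED from the v11/v13 re-cut** (five prints ∧ Mazur Cor. 4.1 [∧ BRR 2022 Thm. 1, unused here]) by the INPUTS desk's
`InputsPublishedNs.publishedInputs_ns_of_five_of_mazur` (p640631: the period-unit pair F5/F6 from Mazur via Skinner–Urban's
`realPeriodRat_eq_unit_mul_plusPeriod_of_mazur`). No sorry of its own. -/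
theorem publishedInputs_of_stubs :
    Literature.NumberTheory.EllipticCurves.Kobayashi2003.thm41_signedCharIdeal_divisibility ∧
    Literature.NumberTheory.EllipticCurves.Kobayashi2003.thm12_signedSelmerDual_finite_torsion ∧
    Literature.NumberTheory.EllipticCurves.realPeriodRat_eq_unit_mul_plusPeriod ∧
    Literature.NumberTheory.EllipticCurves.realPeriodRat_eq_unit_mul_plusPeriod_three ∧
    Literature.NumberTheory.EllipticCurves.Kobayashi2003.thm62_63_73_signedColemanKato_zeta ∧
    Literature.NumberTheory.EllipticCurves.ModularForms.nonempty_modularParametrizationData ∧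
    Literature.NumberTheory.EllipticCurves.BurungaleCastellaSkinner2025.prop422_greenbergAnyRoot_hasUnitContent_minus :=
  Summit.BirchSwinnertonDyer.BirchSwinnertonDyer.Theorems.SignedLowerHalves.InputsPublishedNs.publishedInputs_ns_of_five_of_mazur
    stub_publishedInputs_ns.1 stub_publishedInputs_ns.2.1

/-- stub (PRE, cite-only — PREPRINT binders, arXiv:2409.01350v2): BSTW Thm 6.17 common Katz frame (GSF) and the
signed two-variable package (P1)–(P3). -/
theorem stub_preprintInputs_ns :
    Literature.NumberTheory.EllipticCurves.BurungaleSkinnerTianWan2024.thm617_exists_commonKatzFrame_isGreenbergLFunctionAnyRoot₂_supersingular_PRE ∧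
    Literature.NumberTheory.EllipticCurves.BurungaleSkinnerTianWan2024.props118_27_519_exists_signedTwoVariablePackage_supersingular_PRE := by
  sorry

/-- stub (v12; the `p = 3` Eisenstein half CUT TO ITS `p`-INVERTED λ-PART, both signs): on the crux's `p = 3` rows, for every
sign `ε`, every cyclotomic datum and every Pontryagin-dual datum `D` of `Sel^ε(E/ℚ_∞)`: `char X^ε = (g)` with `ϖ·L³_ε·h = 3^m·g` in
`ℚ₃⟦T⟧` for some `h`, `m` — VERBATIM crux 3's `LambdaLowerDivisibility W 3 ε` (line `horocycle_mu_floor`, item 19001) unfolded, with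
this crux's binders (`¬Surj`; the image binder is idle in every known engine).  OPEN / PRE-adjacent (the Eisenstein direction of the
rational signed IMC at `p = 3` off the square-free locus).  The integral `∃ ε` half is DERIVED below. -/
theorem stub_lambdaLowerThree_ns : ∀ (W : WeierstrassCurve ℚ) [W.IsElliptic] [W.IsGloballyMinimal] (p : ℕ) [Fact p.Prime],
    p = 3 → ClassX7 W p → ¬ W.HasCM → W.frobeniusTrace p = 0 → ¬ Surj W p →
    ∀ (ε : ℤˣ) (κ : ZpExtension ℚ p) (γ : Field.absoluteGaloisGroup ℚ),
        κ.IsCyclotomic → κ.IsTopGenerator γ → IsCyclotomicVariable p γ →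
      ∀ [NeZero (W.conductorNorm ℤ)] (f : CuspForm (Gamma0 (W.conductorNorm ℤ)) 2),
        IsNewformOf W f → ∀ (ϖ : ℚ), (ϖ : ℝ) * W.realPeriodRat = plusPeriod f →
      ∀ (Lplus Lminus : IwasawaAlgebra p), IsPollackPair f p Lplus Lminus →
      ∀ (D : SignedSelmerDualData W κ γ ε),
        ∃ (g h : IwasawaAlgebra p) (m : ℕ), D.charIdeal = Ideal.span {g} ∧
          iwasawaToPowerSeries p (PowerSeries.C ((p : ℤ_[p]) ^ m) * g) =
            PowerSeries.C (ϖ : ℚ_[p]) * iwasawaToPowerSeries p (kobayashiL ε Lplus Lminus * h) := by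
  sorry

/-- **v6–v11's `stub_threeLower_ns` (the INTEGRAL Eisenstein half `∃ ε, KobayashiLowerDivisibility W 3 ε`) DERIVED from the v12 λ-stub**
by the image-free tree theorem `HorocycleMuFloor.X7.exists_kobayashiLowerDivisibility_three_of_pInverted` (w2 g5, p648511): μ-side = the
input-free `p = 3` rider of this crux (p643729), upgrade = the door p647721, period unit = `h3`, the 4th conjunct of `publishedInputs_of_stubs`
(Mazur 1978 Cor. 4.1 via the INPUTS desk).  No sorry of its own. -/
theorem threeLower_of_stubs : ∀ (W : WeierstrassCurve ℚ) [W.IsElliptic] [W.IsGloballyMinimal] (p : ℕ) [Fact p.Prime],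
    p = 3 → ClassX7 W p → ¬ W.HasCM → W.frobeniusTrace p = 0 → ¬ Surj W p →
    ∃ ε : ℤˣ, Summit.BirchSwinnertonDyer.Rank1Residual.Supersingular.KobayashiLowerDivisibility W p ε := by
  intro W _ _ p _ hp3 hX hCM hap hs
  subst hp3
  obtain ⟨-, -, -, h3, -⟩ := publishedInputs_of_stubs
  exact Summit.BirchSwinnertonDyer.BirchSwinnertonDyer.Theorems.HorocycleMuFloor.X7.exists_kobayashiLowerDivisibility_three_of_pInverted
    W h3 hX hap (fun ε ↦ stub_lambdaLowerThree_ns W 3 rfl hX hCM hap hs ε)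

/-- composition = THE SKELETON: the crux BY NAME from the six stubs, by the landed
`SmallImageAcnsCrux.kobayashiMainConjectureSmallImage_of_acns` (5 ≤ p: T3 + one-sign μ + held inputs ⇒ lower
at the rider's sign, saturation at every sign from the same rider; p = 3: the Eisenstein half (v12: derived from the λ-stub,
`threeLower_of_stubs`) + saturation), the rider supplied by `muOneSign_of_stubs` (v6). No sorry of its own. -/
theorem KobayashiMainConjectureSmallImage_of :
    Summit.BirchSwinnertonDyer.BirchSwinnertonDyer.Theses.SignedLowerHalves.KobayashiMainConjectureSmallImage := by
  obtain ⟨h41, h12, h5, h3, hCK, hmodP, h422⟩ := publishedInputs_of_stubs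
  obtain ⟨hGF, hpkg⟩ := stub_preprintInputs_ns
  exact Summit.BirchSwinnertonDyer.BirchSwinnertonDyer.Theorems.SmallImageAcnsCrux.kobayashiMainConjectureSmallImage_of_acns
    hCK h12 h41 h5 h3 hmodP h422 hpkg hGF canonical_ns_of_stubs muOneSign_of_stubs threeLower_of_stubs

end Summit.BirchSwinnertonDyer.BirchSwinnertonDyer.Cruxes.KobayashiMainConjectureSmallImage.BirthAcns

end
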